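import Literature.MathematicalPhysics.QuantumFieldTheory.Balaban1983to89.BlockAveraging
import HarnessLib

/-!
# `Balaban1983to89.LatticeWordStokes` — the CRUDE NON-ABELIAN LATTICE STOKES BOUND for closed words: if every plaquette variable is within
# `δ` of `1`, the holonomy of the walk spelled by ANY word with zero net displacement is within `(|w|²/4)·δ` of `1`

Cell `ym3-torus` (HUMAN RULING D-0037, YM ladder rung R3), seat `ym3-torus-p1` gen 6 (UV side); cell record HOME/UV3-NODE.md §15.  WHY: every
use of Bałaban's block averaging (0.4) of [Balaban1987RG1] on SMALL fields needs «the (0.4) loop variables `U(Γ ∪ [x,x′] ∪ (−Γ′) ∪ (−c))`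
of a configuration with plaquette variables within `δ` of `1` are within `c(L)·δ` of `1`» (the guard `BlockAveraging.Small`, cell gap G-K1a-5;
[Balaban1985Averaging] Prop 1 (51) for (0.4), the schema `T3LowerAlongMinimisersSplit.Prop1EmlAt`) — a non-abelian Stokes estimate for the
loop words `BlockAveraging.loopWord`.  This module proves the estimate for ALL closed words at once, in the crude form that suffices.

THE ARGUMENT (elementary; [Balaban1985Averaging] (19)–(20) p. 21: `|XY − 1| ≤ |X − 1| + |Y − 1|`, `|X⁻¹ − 1| = |X − 1|`, unitary
invariance).  For a configuration `U` on `T^{(j)}` and a word `w` (letters `±e_μ`), `𝒰_x(w) = holAt U (walk x w)`.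
* §1 site arithmetic and the holonomy of two-letter words.
* §2 **THE COMMUTATOR DEFECT IS A PLAQUETTE**: for letters `m₁, m₂`, `D := 𝒰_y(m₁m₂)·𝒰_y(m₂m₁)⁻¹` is `1` if `m₁, m₂` are parallel and a
  conjugate of a plaquette variable or its inverse otherwise; hence `|D − 1| ≤ δ` under `PlaqSmall δ U` (`dist1_swapDefect_le`).
* §3 **ADJACENT TRANSPOSITIONS COST ONE PLAQUETTE**: `|𝒰_x(A m₁ m₂ C) − 1| ≤ δ + |𝒰_x(A m₂ m₁ C) − 1|` (`dist1_holAt_swap_le`) — the two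
  holonomies differ by the conjugate `𝒰_x(A)·D·𝒰_x(A)⁻¹`.
* §4 **BACKTRACKS ARE FREE**: `𝒰_x(A m m̄ C) = 𝒰_x(A C)` (`holAt_walk_backtrack`); moving a letter `m̄` leftward through `B` to its partner:
  `|𝒰_x(A m B m̄ C) − 1| ≤ |B|·δ + |𝒰_x(A B C) − 1|` (`dist1_holAt_cancel_le`).
* §5 **THE BOUND**: a nonempty word with zero net displacement in every direction contains, after its first letter `m`, the letter `m̄`;
  cancelling the pair costs at most `(|w| − 2)·δ`; induction on the length gives
  **`dist1_holAt_le_of_netDisp_eq_zero`**: `|𝒰_x(w) − 1| ≤ (|w|²/4)·δ` for every base site `x`, every word `w` with `netDisp w ≡ 0`, every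
  `δ ≥ 0` with `PlaqSmall δ U`.  (Words winding around the torus — `netDisp ≠ 0` but closed modulo the period, e.g. Polyakov loops — are
  rightly excluded.)
* §6 corollaries for the tree's loop words of (0.4): `length_loopWord_le` (`≤ (d+2)L`), **`dist1_loopHol_le`** (every (0.4) loop
  variable within `(((d+2)L)²/4)·δ` of `1`), **`small_of_plaqSmall`** (the guard `BlockAveraging.Small ℰ U c` holds at every coarse bond once
  `(((d+2)L)²/4)·δ < δ_ℰ` — the family's total averaging IS (0.4) on small fields: the Stokes half of cell gap G-K1a-5, PROVED).

PRIOR ART IN THE TREE (same method, found by the gate's dedup at filing): the T⁴ programme's SUMMITS-side support files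
`Summits/QuantumFields/BalabanUV/T4Continuum/Support/B13AvgCorrStokes.lean` + `B13AvgCorrStokesLoop.lean` (cell `pub-balaban`, NE5 κ-discharge,
leaf κ-L1) prove the swap ∕ cancellation calculus (`dist1_holAt_pair_swap`, `holAt_walk_cancel` ≡ this file's `holAt_walk_backtrack`,
`dist1_holAt_block_past`, …) and the loop-word bound `dist1 (loopHol U c i) ≤ (d∕2 + d²∕8)·L²·s` (a sharper constant than §6's
`((d+2)L)²/4`).  Those modules live under `Summits/` and cannot be imported by `Literature/` modules (the d = 3 family `T3…`, `BlockAveraging`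
consumers); this file is the LITERATURE-side statement for arbitrary closed words, written independently on the same idea, so that the
Literature cone can use it.  Nothing here is claimed as new mathematics.

References: T. Bałaban, «Averaging operations for lattice gauge theories», CMP 98 (1985) 17–51 [Balaban1985Averaging] ((19)–(20) p.21, Prop. 1
(51) p.26); «Renormalization group approach to lattice gauge field theories. I», CMP 109 (1987) 249–301 [Balaban1987RG1] ((0.4) p.253).
-/

namespace Literature.MathematicalPhysics.QuantumFieldTheory.Balaban1983to89.LatticeWordStokes

open T4Continuum T4ReflectionCone

variable {P : Params} {j : ℕ} {G : Type*} [GaugeGroup G]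

/-! ## §1 Site arithmetic; holonomies of one- and two-letter words -/

section Sites

/-- `(x + e_a) − e_a = x`. [folklore] -/
private theorem unshift_shift (x : Site P j) (a : Fin P.d) : (x.shift a).unshift a = x := by
  funext i
  by_cases h : i = a
  · subst h; simp [Site.shift, Site.unshift]
  · simp [Site.shift, Site.unshift, h]

/-- `(x − e_a) + e_a = x`. [folklore] -/
private theorem shift_unshift (x : Site P j) (a : Fin P.d) : (x.unshift a).shift a = x := by
  funext i
  by_cases h : i = a
  · subst h; simp [Site.shift, Site.unshift]
  · simp [Site.shift, Site.unshift, h]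

/-- `(x + e_a) + e_b = (x + e_b) + e_a`. [folklore] -/
private theorem shift_shift_comm (x : Site P j) (a b : Fin P.d) : (x.shift a).shift b = (x.shift b).shift a := by
  funext i
  by_cases ha : i = a <;> by_cases hb : i = b
  · subst ha; subst hb; rfl
  · subst ha; simp [Site.shift, hb]
  · subst hb; simp [Site.shift, ha]
  · simp [Site.shift, ha, hb]

/-- `(x − e_a) − e_b = (x − e_b) − e_a`. [folklore] -/
private theorem unshift_unshift_comm (x : Site P j) (a b : Fin P.d) : (x.unshift a).unshift b = (x.unshift b).unshift a := by
  funext i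
  by_cases ha : i = a <;> by_cases hb : i = b
  · subst ha; subst hb; rfl
  · subst ha; simp [Site.unshift, hb]
  · subst hb; simp [Site.unshift, ha]
  · simp [Site.unshift, ha, hb]

/-- `(x + e_a) − e_b = (x − e_b) + e_a`. [folklore] -/
private theorem shift_unshift_comm (x : Site P j) (a b : Fin P.d) : (x.shift a).unshift b = (x.unshift b).shift a := by
  by_cases hab : a = b
  · subst hab; rw [unshift_shift, shift_unshift]
  funext i
  by_cases ha : i = a <;> by_cases hb : i = b
  · exact absurd (ha.symm.trans hb) hab
  · subst ha; simp [Site.shift, Site.unshift, hb]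
  · subst hb; simp [Site.shift, Site.unshift, ha]
  · simp [Site.shift, Site.unshift, ha, hb]

end Sites

section TwoLetters

variable (U : GaugeField P j G) (y : Site P j) (a b : Fin P.d)

/-- `𝒰_y(+a, +b) = U⟨y,a⟩·U⟨y+a,b⟩` (parallel transport (9) along a two-bond contour). [cite: Balaban1985Averaging, (9) p.19] -/
theorem holAt_walk_tt : holAt U (walk y [(a, true), (b, true)]) = U ⟨y, a⟩ * U ⟨y.shift a, b⟩ := by
  simp [walk, holAt_cons, holAt_nil]

/-- `𝒰_y(+a, −b) = U⟨y,a⟩·U⟨y+a−b,b⟩⁻¹` ((9) with (7): `U(x, x′) = U(x′, x)⁻¹`). [cite: Balaban1985Averaging, (9) p.19] -/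
theorem holAt_walk_tf : holAt U (walk y [(a, true), (b, false)]) = U ⟨y, a⟩ * (U ⟨(y.shift a).unshift b, b⟩)⁻¹ := by
  simp [walk, holAt_cons, holAt_nil]

/-- `𝒰_y(−a, +b) = U⟨y−a,a⟩⁻¹·U⟨y−a,b⟩` ((9) with (7)). [cite: Balaban1985Averaging, (9) p.19] -/
theorem holAt_walk_ft : holAt U (walk y [(a, false), (b, true)]) = (U ⟨y.unshift a, a⟩)⁻¹ * U ⟨y.unshift a, b⟩ := by
  simp [walk, holAt_cons, holAt_nil]

/-- `𝒰_y(−a, −b) = U⟨y−a,a⟩⁻¹·U⟨y−a−b,b⟩⁻¹` ((9) with (7)). [cite: Balaban1985Averaging, (9) p.19] -/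
theorem holAt_walk_ff : holAt U (walk y [(a, false), (b, false)]) = (U ⟨y.unshift a, a⟩)⁻¹ * (U ⟨(y.unshift a).unshift b, b⟩)⁻¹ := by
  simp [walk, holAt_cons, holAt_nil]

end TwoLetters

/-! ## §2 The commutator defect of two letters is a plaquette (or trivial) -/

section Defect

variable (U : GaugeField P j G)

/-- `|hgh⁻¹ − 1| < δ` and `|hg⁻¹h⁻¹ − 1| < δ` from `|g − 1| < δ` (unitary invariance, [Balaban1985Averaging] (19)–(20)). [cite: Balaban1985Averaging, (19)-(20) p.21] -/
theorem dist1_conj_lt {g x : G} (h : G) {δ : ℝ} (hg : dist1 g < δ) (hx : x = h * g * h⁻¹ ∨ x = h * g⁻¹ * h⁻¹) : dist1 x < δ := by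
  rcases hx with rfl | rfl
  · rwa [GaugeGroup.dist1_conj]
  · rwa [GaugeGroup.dist1_conj, GaugeGroup.dist1_inv]

/-- **THE COMMUTATOR DEFECT, ORDERED NON-PARALLEL CASE** (`a < b`): `𝒰_y((a,s)(b,t))·𝒰_y((b,t)(a,s))⁻¹` is a conjugate of the plaquette
variable `U(∂p)^{±1}` of the plaquette `p = ⟨z, a, b⟩` at `z ∈ {y, y−a, y−b, y−a−b}`; hence within `δ` of `1` under `PlaqSmall δ U`.
[cite: Balaban1985Averaging, (9) p.19 and (19)-(20) p.21] -/
theorem dist1_swapDefect_lt_of_lt {δ : ℝ} (hU : PlaqSmall δ U) (y : Site P j) {a b : Fin P.d} (hab : a < b) (s t : Bool) :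
    dist1 (holAt U (walk y [(a, s), (b, t)]) * (holAt U (walk y [(b, t), (a, s)]))⁻¹) < δ := by
  cases s <;> cases t
  · -- (−a, −b): plaquette at z = y − a − b
    have hp := hU ⟨(y.unshift a).unshift b, a, b, hab⟩
    refine dist1_conj_lt (U ⟨(y.unshift a).unshift b, a⟩ * U ⟨((y.unshift a).unshift b).shift a, b⟩)⁻¹ hp (Or.inl ?_)
    rw [holAt_walk_ff, holAt_walk_ff]
    simp only [GaugeField.plaqHol]
    rw [unshift_unshift_comm y b a, shift_unshift _, show ((y.unshift a).unshift b).shift a = y.unshift b by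
      rw [unshift_unshift_comm, shift_unshift]]
    group
  · -- (−a, +b): plaquette at z = y − a
    have hp := hU ⟨y.unshift a, a, b, hab⟩
    refine dist1_conj_lt (U ⟨y.unshift a, a⟩)⁻¹ hp (Or.inr ?_)
    rw [holAt_walk_ft, holAt_walk_tf]
    simp only [GaugeField.plaqHol]
    rw [shift_unshift, shift_unshift_comm y b a]
    group
  · -- (+a, −b): plaquette at z = y − b
    have hp := hU ⟨y.unshift b, a, b, hab⟩
    refine dist1_conj_lt (U ⟨y.unshift b, b⟩)⁻¹ hp (Or.inr ?_)
    rw [holAt_walk_tf, holAt_walk_ft]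
    simp only [GaugeField.plaqHol]
    rw [shift_unshift, shift_unshift_comm y a b]
    group
  · -- (+a, +b): the plaquette at y itself
    have hp := hU ⟨y, a, b, hab⟩
    refine dist1_conj_lt 1 hp (Or.inl ?_)
    rw [holAt_walk_tt, holAt_walk_tt]
    simp only [GaugeField.plaqHol]
    group

/-- The defect of `(m₂, m₁)` is the inverse of the defect of `(m₁, m₂)`. [folklore] -/
private theorem swapDefect_symm (y : Site P j) (m₁ m₂ : Letter P.d) :
    holAt U (walk y [m₂, m₁]) * (holAt U (walk y [m₁, m₂]))⁻¹ = (holAt U (walk y [m₁, m₂]) * (holAt U (walk y [m₂, m₁]))⁻¹)⁻¹ := by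
  group

/-- **PARALLEL LETTERS HAVE NO DEFECT**: for letters in the same direction, `𝒰_y(m₁m₂) = 𝒰_y(m₂m₁)` (equal letters trivially; opposite
letters: both two-letter words are backtracks with holonomy `1`, by (7) `U(x, x′) = U(x′, x)⁻¹`). [cite: Balaban1985Averaging, (7) and (9) pp.18-19] -/
theorem swapDefect_eq_one_of_parallel (y : Site P j) (a : Fin P.d) (s t : Bool) :
    holAt U (walk y [(a, s), (a, t)]) * (holAt U (walk y [(a, t), (a, s)]))⁻¹ = 1 := by
  cases s <;> cases t
  · simp
  · rw [holAt_walk_ft, holAt_walk_tf, unshift_shift]; group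
  · rw [holAt_walk_tf, holAt_walk_ft, unshift_shift]; group
  · simp

/-- **THE COMMUTATOR DEFECT OF ANY TWO LETTERS IS WITHIN `δ` OF `1`** under `PlaqSmall δ U`, `δ ≥ 0`. [cite: Balaban1985Averaging, (9) p.19 and (19)-(20) p.21] -/
theorem dist1_swapDefect_le {δ : ℝ} (hδ : 0 ≤ δ) (hU : PlaqSmall δ U) (y : Site P j) (m₁ m₂ : Letter P.d) :
    dist1 (holAt U (walk y [m₁, m₂]) * (holAt U (walk y [m₂, m₁]))⁻¹) ≤ δ := by
  obtain ⟨a, s⟩ := m₁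
  obtain ⟨b, t⟩ := m₂
  rcases lt_trichotomy a b with hab | rfl | hba
  · exact (dist1_swapDefect_lt_of_lt U hU y hab s t).le
  · rw [swapDefect_eq_one_of_parallel, GaugeGroup.dist1_one]; exact hδ
  · rw [← inv_inv (holAt U (walk y [(a, s), (b, t)]) * (holAt U (walk y [(b, t), (a, s)]))⁻¹), GaugeGroup.dist1_inv,
      ← swapDefect_symm]
    exact (dist1_swapDefect_lt_of_lt U hU y hba t s).le

end Defect

/-! ## §3 Adjacent transpositions cost one plaquette -/

section Swap

variable (U : GaugeField P j G)

/-- Two-letter words that are permutations of each other end at the same site. [folklore] -/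
private theorem walkEnd_pair_comm (y : Site P j) (m₁ m₂ : Letter P.d) : walkEnd y [m₁, m₂] = walkEnd y [m₂, m₁] := by
  funext ν
  rw [walkEnd_apply, walkEnd_apply, netDisp_cons, netDisp_cons, netDisp_cons, netDisp_cons]
  congr 1
  push_cast
  ring

/-- **THE SWAP IDENTITY**: `𝒰_x(A m₁ m₂ C) = [𝒰_x(A)·D·𝒰_x(A)⁻¹]·𝒰_x(A m₂ m₁ C)` with `D` the commutator defect of `m₁, m₂` at the end of `A`
(multiplicativity of the parallel transport (9) along concatenated contours). [cite: Balaban1985Averaging, (9) p.19] -/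
theorem holAt_walk_swap_eq (x : Site P j) (A C : List (Letter P.d)) (m₁ m₂ : Letter P.d) :
    holAt U (walk x (A ++ m₁ :: m₂ :: C)) =
      (holAt U (walk x A) * (holAt U (walk (walkEnd x A) [m₁, m₂]) * (holAt U (walk (walkEnd x A) [m₂, m₁]))⁻¹) *
          (holAt U (walk x A))⁻¹) * holAt U (walk x (A ++ m₂ :: m₁ :: C)) := by
  have h₁ : A ++ m₁ :: m₂ :: C = A ++ ([m₁, m₂] ++ C) := by simp
  have h₂ : A ++ m₂ :: m₁ :: C = A ++ ([m₂, m₁] ++ C) := by simp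
  rw [h₁, h₂]
  simp only [walk_append, holAt_append]
  rw [walkEnd_pair_comm (walkEnd x A) m₁ m₂]
  group

/-- **AN ADJACENT TRANSPOSITION COSTS AT MOST `δ`**: `|𝒰_x(A m₁ m₂ C) − 1| ≤ δ + |𝒰_x(A m₂ m₁ C) − 1|` under `PlaqSmall δ U`, `δ ≥ 0`.
[cite: Balaban1985Averaging, (19)-(20) p.21] -/
theorem dist1_holAt_swap_le {δ : ℝ} (hδ : 0 ≤ δ) (hU : PlaqSmall δ U) (x : Site P j) (A C : List (Letter P.d)) (m₁ m₂ : Letter P.d) :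
    dist1 (holAt U (walk x (A ++ m₁ :: m₂ :: C))) ≤ δ + dist1 (holAt U (walk x (A ++ m₂ :: m₁ :: C))) := by
  rw [holAt_walk_swap_eq U x A C m₁ m₂]
  refine (GaugeGroup.dist1_mul_le _ _).trans ?_
  rw [GaugeGroup.dist1_conj]
  exact add_le_add (dist1_swapDefect_le U hδ hU _ m₁ m₂) le_rfl

end Swap

/-! ## §4 Backtracks are free; moving a letter to its partner -/

section Cancel

variable (U : GaugeField P j G)

/-- A backtrack `m m̄` has holonomy `1` and returns to its base. [folklore] -/
private theorem holAt_walk_pair_flip (y : Site P j) (m : Letter P.d) :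
    holAt U (walk y [m, m.flip]) = 1 ∧ walkEnd y [m, m.flip] = y := by
  obtain ⟨a, s⟩ := m
  cases s
  · refine ⟨?_, ?_⟩
    · simp [walk, holAt_cons, holAt_nil, Letter.flip]
    · show (y.unshift a).shift a = y
      exact shift_unshift y a
  · refine ⟨?_, ?_⟩
    · simp [walk, holAt_cons, holAt_nil, Letter.flip, unshift_shift]
    · show (y.shift a).unshift a = y
      exact unshift_shift y a

/-- **BACKTRACKS ARE FREE**: `𝒰_x(A m m̄ C) = 𝒰_x(A C)` ((7): `U(x, x′) = U(x′, x)⁻¹`). [cite: Balaban1985Averaging, (7) and (9) pp.18-19] -/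
theorem holAt_walk_backtrack (x : Site P j) (A C : List (Letter P.d)) (m : Letter P.d) :
    holAt U (walk x (A ++ m :: m.flip :: C)) = holAt U (walk x (A ++ C)) := by
  have h₁ : A ++ m :: m.flip :: C = A ++ ([m, m.flip] ++ C) := by simp
  obtain ⟨hhol, hend⟩ := holAt_walk_pair_flip U (walkEnd x A) m
  rw [h₁, walk_append, walk_append, holAt_append, holAt_append, hhol, hend, one_mul, ← holAt_append, ← walk_append]

/-- **MOVING `m̄` LEFTWARD THROUGH `B` TO ITS PARTNER `m` COSTS `|B|` PLAQUETTES**: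
`|𝒰_x(A m B m̄ C) − 1| ≤ |B|·δ + |𝒰_x(A B C) − 1|` (`PlaqSmall δ U`, `δ ≥ 0`). [cite: Balaban1985Averaging, (19)-(20) p.21] -/
theorem dist1_holAt_cancel_le {δ : ℝ} (hδ : 0 ≤ δ) (hU : PlaqSmall δ U) (x : Site P j) (m : Letter P.d) :
    ∀ (B A C : List (Letter P.d)),
      dist1 (holAt U (walk x (A ++ m :: (B ++ m.flip :: C)))) ≤ (B.length : ℝ) * δ + dist1 (holAt U (walk x (A ++ (B ++ C))))
  | [], A, C => by
    simp only [List.nil_append, List.length_nil, Nat.cast_zero, zero_mul, zero_add]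
    rw [holAt_walk_backtrack]
  | b :: B, A, C => by
    have h₁ : A ++ b :: m :: (B ++ m.flip :: C) = (A ++ [b]) ++ m :: (B ++ m.flip :: C) := by simp
    have h₂ : A ++ (b :: B ++ C) = (A ++ [b]) ++ (B ++ C) := by simp
    calc dist1 (holAt U (walk x (A ++ m :: (b :: B ++ m.flip :: C))))
        ≤ δ + dist1 (holAt U (walk x (A ++ b :: m :: (B ++ m.flip :: C)))) := dist1_holAt_swap_le U hδ hU x A _ m b
      _ ≤ δ + ((B.length : ℝ) * δ + dist1 (holAt U (walk x (A ++ (b :: B ++ C))))) := by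
          rw [h₁, h₂]
          exact add_le_add le_rfl (dist1_holAt_cancel_le hδ hU x m B (A ++ [b]) C)
      _ = ((b :: B).length : ℝ) * δ + dist1 (holAt U (walk x (A ++ (b :: B ++ C)))) := by
          simp only [List.length_cons, Nat.cast_succ]
          ring

end Cancel

/-! ## §5 The bound for closed words -/

section Main

variable (U : GaugeField P j G)

/-- A word with positive net displacement in direction `a` contains the letter `+e_a`; with negative, the letter `−e_a`. [folklore] -/
private theorem mem_of_netDisp_ne (a : Fin P.d) : ∀ (w : List (Letter P.d)),
    (0 < netDisp w a → (a, true) ∈ w) ∧ (netDisp w a < 0 → (a, false) ∈ w)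
  | [] => by simp [netDisp]
  | l :: w => by
    obtain ⟨hpos, hneg⟩ := mem_of_netDisp_ne a w
    obtain ⟨b, s⟩ := l
    constructor
    · intro h
      rw [netDisp_cons] at h
      by_cases hb : b = a
      · subst hb
        cases s
        · exact List.mem_cons_of_mem _ (hpos (by simp at h; linarith))
        · exact List.mem_cons_self
      · exact List.mem_cons_of_mem _ (hpos (by simp [hb] at h; exact h))
    · intro h
      rw [netDisp_cons] at h
      by_cases hb : b = a
      · subst hb
        cases s
        · exact List.mem_cons_self
        · exact List.mem_cons_of_mem _ (hneg (by simp at h; linarith))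
      · exact List.mem_cons_of_mem _ (hneg (by simp [hb] at h; exact h))

/-- The tail of a closed word beginning with `m` contains `m̄`. [folklore] -/
private theorem flip_mem_of_netDisp_eq_zero (m : Letter P.d) (w : List (Letter P.d)) (h : netDisp (m :: w) m.1 = 0) : m.flip ∈ w := by
  obtain ⟨a, s⟩ := m
  rw [netDisp_cons] at h
  simp only [if_true] at h
  cases s
  · exact (mem_of_netDisp_ne a w).1 (by simp at h; linarith)
  · exact (mem_of_netDisp_ne a w).2 (by simp at h; linarith)

/-- Removing a cancelling pair `m … m̄` keeps every net displacement. [folklore] -/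
private theorem netDisp_remove_pair (m : Letter P.d) (B C : List (Letter P.d)) (ν : Fin P.d) :
    netDisp (m :: (B ++ m.flip :: C)) ν = netDisp (B ++ C) ν := by
  obtain ⟨a, s⟩ := m
  simp only [netDisp_cons, netDisp_append, Letter.flip]
  by_cases ha : a = ν
  · subst ha; cases s <;> simp <;> ring
  · simp [ha]

/-- **THE CRUDE NON-ABELIAN LATTICE STOKES BOUND.**  If every plaquette variable of `U` is within `δ ≥ 0` of `1`, then for every word `w`
with zero net displacement in every direction and every base site `x`, `|𝒰_x(w) − 1| ≤ (|w|²/4)·δ`.  Proof: the first letter `m` has a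
partner `m̄` later in the word (`flip_mem_of_netDisp_eq_zero`); moving it next to `m` costs at most `|w| − 2` adjacent transpositions, one
plaquette each (`dist1_holAt_cancel_le`), the pair then cancels, and `(n − 2) + (n − 2)²/4 ≤ n²/4`.
[cite: Balaban1985Averaging, (9) p.19 and (19)-(20) p.21] -/
theorem dist1_holAt_le_of_netDisp_eq_zero {δ : ℝ} (hδ : 0 ≤ δ) (hU : PlaqSmall δ U) :
    ∀ (n : ℕ) (w : List (Letter P.d)), w.length = n → (∀ ν, netDisp w ν = 0) → ∀ x : Site P j,
      dist1 (holAt U (walk x w)) ≤ ((n : ℝ) ^ 2 / 4) * δ := by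
  intro n
  induction n using Nat.strong_induction_on with
  | _ n ih =>
    intro w hlen hnull x
    cases w with
    | nil =>
      subst hlen
      simp only [walk, holAt_nil, GaugeGroup.dist1_one]
      positivity
    | cons m w' =>
      have hmem : m.flip ∈ w' := flip_mem_of_netDisp_eq_zero m w' (hnull m.1)
      obtain ⟨B, C, hw'⟩ := List.append_of_mem hmem
      subst hw'
      have hstep := dist1_holAt_cancel_le U hδ hU x m B [] C
      simp only [List.nil_append] at hstep
      have hnull' : ∀ ν, netDisp (B ++ C) ν = 0 := fun ν => by rw [← netDisp_remove_pair m B C ν]; exact hnull ν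
      simp only [List.length_cons, List.length_append] at hlen
      have hlen' : (B ++ C).length = n - 2 := by simp; omega
      have h2n : 2 ≤ n := by omega
      have ih' := ih (n - 2) (by omega) (B ++ C) hlen' hnull' x
      have hB : (B.length : ℝ) ≤ (n : ℝ) - 2 := by
        have h : (B.length : ℝ) + 2 ≤ n := by exact_mod_cast (show B.length + 2 ≤ n by omega)
        linarith
      have hcast : (((n - 2 : ℕ) : ℝ)) = (n : ℝ) - 2 := by rw [Nat.cast_sub h2n]; norm_num
      calc dist1 (holAt U (walk x (m :: (B ++ m.flip :: C))))
          ≤ (B.length : ℝ) * δ + dist1 (holAt U (walk x (B ++ C))) := hstep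
        _ ≤ ((n : ℝ) - 2) * δ + ((((n - 2 : ℕ) : ℝ)) ^ 2 / 4) * δ := add_le_add (mul_le_mul_of_nonneg_right hB hδ) ih'
        _ ≤ ((n : ℝ) ^ 2 / 4) * δ := by rw [hcast]; nlinarith

/-- The same bound stated with the word's own length. [cite: Balaban1985Averaging, (9) p.19 and (19)-(20) p.21] -/
theorem dist1_holAt_le {δ : ℝ} (hδ : 0 ≤ δ) (hU : PlaqSmall δ U) (w : List (Letter P.d)) (hw : ∀ ν, netDisp w ν = 0)
    (x : Site P j) : dist1 (holAt U (walk x w)) ≤ ((w.length : ℝ) ^ 2 / 4) * δ :=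
  dist1_holAt_le_of_netDisp_eq_zero U hδ hU w.length w rfl hw x

end Main

/-! ## §6 The loop variables of the (0.4) block averaging on small fields -/

section LoopWords

open BlockAveraging

/-- A run of `|k|` letters has length `|k|`. [folklore] -/
private theorem length_axisRun {d : ℕ} (μ : Fin d) (k : ℤ) : (axisRun μ k).length = k.natAbs := by
  simp [axisRun]

/-- The staircase through a list of axes has length `Σ |n_a|`. [folklore] -/
private theorem length_stairRuns {d : ℕ} (n : Fin d → ℤ) : ∀ as : List (Fin d), (stairRuns n as).length = (as.map fun a => (n a).natAbs).sum
  | [] => rfl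
  | a :: as => by rw [stairRuns, List.length_append, length_axisRun, length_stairRuns n as, List.map_cons, List.sum_cons]

/-- A staircase word `Γ ∈ G(y, x)` with all `|n_ν| ≤ N` has length at most `d·N`. [cite: Balaban1987RG1, (0.3) p.252] -/
theorem length_stairWord_le {d : ℕ} (σ : Equiv.Perm (Fin d)) (n : Fin d → ℤ) (N : ℕ) (hn : ∀ ν, (n ν).natAbs ≤ N) :
    (stairWord σ n).length ≤ d * N := by
  rw [stairWord, length_stairRuns]
  have h : ∀ (as : List (Fin d)), (as.map fun a => (n a).natAbs).sum ≤ as.length * N := by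
    intro as
    induction as with
    | nil => simp
    | cons a as ih =>
      simp only [List.map_cons, List.sum_cons, List.length_cons]
      have := hn a
      nlinarith
  exact (h _).trans (by rw [List.length_map, List.length_finRange])

/-- A reversed word has the same length. [folklore] -/
private theorem length_wordRev {d : ℕ} (w : List (Letter d)) : (wordRev w).length = w.length := by
  simp [wordRev]

/-- **THE LOOP WORDS OF (0.4) HAVE LENGTH AT MOST `(d + 2)·L`** (two staircases of length `≤ d·(L−1)/2 ≤ d·L/2` each, the transported bond
and the bond backwards, `L` each). [cite: Balaban1987RG1, (0.4) p.253] -/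
theorem length_loopWord_le (c : PBond P (j + 1)) (i : Idx P) :
    (loopWord P.L c.dir (off i.1) i.2.1 i.2.2).length ≤ (P.d + 2) * P.L := by
  have hN : ∀ ν, (off i.1 ν).natAbs ≤ (P.L - 1) / 2 := by
    intro ν
    have h := off_bounds i.1 ν
    omega
  have h₁ := length_stairWord_le i.2.1 (off i.1) _ hN
  have h₂ := length_stairWord_le i.2.2 (off i.1) _ hN
  simp only [loopWord, List.length_append, List.length_replicate, length_wordRev]
  have hhalf : 2 * ((P.L - 1) / 2) ≤ P.L := by omega
  nlinarith

/-- **THE (0.4) LOOP VARIABLES OF A SMALL FIELD ARE SMALL**: under `PlaqSmall δ U` (`δ ≥ 0`), every loop variable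
`U(Γ ∪ [x,x′] ∪ (−Γ′) ∪ (−c))` of [Balaban1987RG1] (0.4) (tree `BlockAveraging.loopHol`) is within `(((d+2)L)²/4)·δ` of `1` — the loop
words are closed (`netDisp_loopWord`) of length `≤ (d+2)L`. [cite: Balaban1987RG1, (0.4) p.253] -/
theorem dist1_loopHol_le {δ : ℝ} (hδ : 0 ≤ δ) {U : GaugeField P j G} (hU : PlaqSmall δ U) (c : PBond P (j + 1)) (i : Idx P) :
    dist1 (loopHol U c i) ≤ ((((P.d + 2) * P.L : ℕ) : ℝ) ^ 2 / 4) * δ := by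
  have h := dist1_holAt_le U hδ hU (loopWord P.L c.dir (off i.1) i.2.1 i.2.2) (netDisp_loopWord _ _ _ _ _) (emb c.src)
  refine h.trans (mul_le_mul_of_nonneg_right ?_ hδ)
  have hlen : ((loopWord P.L c.dir (off i.1) i.2.1 i.2.2).length : ℝ) ≤ (((P.d + 2) * P.L : ℕ) : ℝ) := by
    exact_mod_cast length_loopWord_le c i
  have h0 : (0 : ℝ) ≤ ((loopWord P.L c.dir (off i.1) i.2.1 i.2.2).length : ℝ) := Nat.cast_nonneg _
  nlinarith

/-- **THE GUARD OF THE (0.4) AVERAGING IS INACTIVE ON SMALL FIELDS**: if every plaquette variable is within `δ` of `1` and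
`(((d+2)L)²/4)·δ < δ_ℰ` (the radius of the small-loop average `ℰ`), then `BlockAveraging.Small ℰ U c` at EVERY coarse bond `c` — so the
family's total averaging `blockAvg ℰ` IS (0.4) literally there (cell gap G-K1a-5, Stokes half). [cite: Balaban1987RG1, (0.4) p.253] -/
theorem small_of_plaqSmall (ℰ : LoopAverage G) {δ : ℝ} (hδ : 0 ≤ δ) {U : GaugeField P j G} (hU : PlaqSmall δ U)
    (hδℰ : ((((P.d + 2) * P.L : ℕ) : ℝ) ^ 2 / 4) * δ < ℰ.δ) (c : PBond P (j + 1)) : Small ℰ U c :=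
  fun i => (dist1_loopHol_le hδ hU c i).trans_lt hδℰ

end LoopWords

end Literature.MathematicalPhysics.QuantumFieldTheory.Balaban1983to89.LatticeWordStokes
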